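/-
Copyright: statement-level skeleton of a published paper (lit-balaban cell, Phase-2 proof seat p13, gen 7). No proof
claims beyond what the kernel checks below.
-/
import Literature.MathematicalPhysics.QuantumFieldTheory.BalabanImbrieJaffe1984to88.BIJ88DirichletReplacement292

/-!
# `BalabanImbrieJaffe1984to88.BIJ88NoDirichlet294` — T. Bałaban, J. Imbrie, A. Jaffe, *Effective action and cluster
properties of the abelian Higgs model*, Commun. Math. Phys. **114** (1988) 257–315 [BalabanImbrieJaffe1988]: Sect. 5.7,
p. 294 — REMOVING THE DIRICHLET BOUNDARY CONDITION OF A SINGLE-SCALE COVARIANCE BY A RANDOM WALK EXPANSION: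
*"We give a random walk expansion for the difference, Σ_X C^{(j)″}(X) … |C^{(j)″}(X, x₁, x₂)| ≦
e^{−cr|x₁−x₂|}e^{−cr(e_j)|X|⁻}e^{−c dist({x₁,x₂},Λ₃^{(m)c})}"* — the THREE-FACTOR bound, PROVED for the `ℤ^d` operators
of [6] = [Balaban1983RegularityDecay] Sect. 5 («model instance»), completing the p. 292 companion
`BIJ88DirichletReplacement292` (same seat) by the decay in the distance to the boundary

statement-level skeleton of published theorems with citation tags; proofs where landed; nothing here is a claim about the Yang–Mills mass gap

PDF held: `paper:balaban1988-cmp114-bij-abelian-higgs-effective-action` (journal page = PDF page + 256); p. 294 [PDF 38]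
read as an IMAGE (CCITT render `pages/original-p038-x2.png`; copy `HOME/lit-balaban-p13/pages/`).

CITATION HEADER (lean-in-tree rule).  Part of the lit-balaban TYPED SKELETON (HOME `run/shared/lean/pub/lit-balaban/`):
WHAT IS REPRODUCED = row **C2.Eq5.7.10-5.7.12** of `HOME/lit-balaban-r16/ROWS-C2-part2.md` (p. 291–294: *"replacements
… → no Dirichlet b.c. (p.294), each with localized remainders"*), the p. 294 sentence; unit `lit-balaban-p13` (gen 7),
owner r16, referee ref-5.  Built BY NAME on `BIJ88DirichletReplacement292` (`sub_eq_sum_diffTerm`, `fiber_eq_singleton`,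
`card_fiber_le_one`, `diffTerm_eq_zero_of_far`, `sdist_inclIdx`), `BIJ88Eq248Lattice` (`XFar`, `Deep`, `eCube`,
`dist_le_of_inBox`), `BIJ88Ineq246Lattice` (`abs_tsum_class_le`, `plen_ge_of_region`, `sdist_le_plen_add_two`,
`inBox_of_term_ne_zero`, `isChain_of_term_ne_zero`, `dL_start_le_plen`, `dist_smul_le`, `K0`), `BIJ88Eq242Lattice`,
`BIJ88RandomWalk242`; nothing restated.

## The print (p. 294 [PDF 38], verbatim)

*"We make a final change in the leading terms, namely we replace C^{(j)}_{B_{m−j}(Λ^{(m)}_3)}(Λ̄^{(m)}_2, u_{k+1}) with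
C^{(j)}(Λ̄^{(m)}_2, u_{k+1}), the covariance without Dirichlet boundary conditions. We give a random walk expansion for
the difference, Σ_X C^{(j)″}(X). It is actually a double expansion, since each term in the usual random walk expansion
still depends on Λ̄^{(m)}_2 through the basic quadratic form [which involves G_j(Λ̄^{(m)}_2, u_{k+1})] and through
operators C^{(j)}_□(Λ̄^{(m)}_2, u_{k+1}). However, each of these can be expanded as described earlier, yielding terms
C^{(j)″}(X) with proper locality properties, and obeying the following bounds: |C^{(j)″}(X, x₁, x₂)| ≦
e^{−cr|x₁−x₂|}e^{−cr(e_j)|X|⁻}e^{−c dist({x₁,x₂},Λ^{(m)c}_3)}."*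

## The typing (model instance, READING declared)

As in `BIJ88DirichletReplacement292`: the `ℤ^d` operator model of [6] Sect. 5 — `A` on `L²(Ω; ℝ^N)`, `Ω ⊂ ℤ^d` finite,
with (5.6) (`B4.Hyp56 Ω A γ₀ c₀ δ₀`), playing the print's covariance WITHOUT the Dirichlet condition (`C^{(j)}(Λ̄₂,u) =
A^{−1}`), and its Dirichlet restriction `A_Λ = B4.compress hΛ A` to `Λ ⊆ Ω` (the print's `B_{m−j}(Λ^{(m)}_3)`;
`C^{(j)}_Λ = A_Λ^{−1}`); cubes of `M ≥ 5` labels, `r(e_k)`-cubes of `s` labels, `ρ = s/4`; the SAME difference terms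
`C″(X)(x₁,x₂) := C_{Ω,X}(x₁,x₂) − Σ_{Y : ι(Y) = X} C_{Λ,Y}(x₁,x₂)` over the cube sets `X` of `Ω` (the "single"
expansion: the dependence of the letters on `Λ̄^{(m)}_2` — the "double expansion" of the print — is not modelled; the
letters are those of `A`).  *"dist({x₁,x₂},Λ₃^{(m)c})"* enters through a number `D` with `D·M ≤ dist(x₁, y)` for every
`y ∈ Ω∖Λ` (label units; the bound with `x₁`'s distance implies the printed one with the minimum over `x₁, x₂`).
* **`sub_eq_locDiff_add_sum`** — the expansion of the difference for ALL `x₁, x₂ ∈ Λ`: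
  `A^{−1}(x₁,x₂) − A_Λ^{−1}(x₁,x₂) = [C_{Ω,loc}(x₁,x₂) − C_{Λ,loc}(x₁,x₂)] + Σ_X C″(X)(x₁,x₂)` (the bracket VANISHES for
  `x₁` deeper than `(s/4 + 2)M`, `BIJ88DirichletReplacement292.sub_eq_sum_diffTerm` / `BIJ88Eq248Lattice.cLoc_eq_of_far`).
* **`plen_ge_of_contact`** (the mechanism, new): a contributing walk whose cube region contains a cube `c` touched by
  the cube of a label `l` whose block contains a point `y` has path length `≥ dist(x₁,y)/M − 3s − 1`.
* **`abs_cX_lattice_le_three`** — the THREE-FACTOR (2.46): for a cube set `X` in such contact with `y`,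
  `|C_{R,X}(x₁,x₂)| ≤ K₀·e^{−(δ₀/24)|x₁−x₂|/M}·e^{−(δ₀s/(192·9^d))|X|}·e^{−(δ₀/24)(D − 3s − 1)}`, `K₀ =
  2^dγ₀^{−1}(1−θ_W)^{−1}e^{δ₀/8}` (`BIJ88Ineq246Lattice.K0`), any region `R` with (5.6).
* **`diffTerm_eq_zero_of_no_contact`** — a cube set `X` of `Ω` NOT in contact with `Ω∖Λ` (no label `l` whose cube
  touches `X` has a point of `Ω∖Λ` in its block) is the push-forward of a far cube set of `Λ` and its term VANISHES.
* **`abs_diffTerm_le_three`** — for EVERY cube set `X` of `Ω` and all `x₁, x₂ ∈ Λ`: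
  `|C″(X)(x₁,x₂)| ≤ 2K₀·e^{−(δ₀/24)·|x₁−x₂|/M}·e^{−(δ₀s/(192·9^d))·|X|}·e^{−(δ₀/24)(D − 3s − 1)}` — the printed three
  factors with explicit constants (the distance to the boundary counted beyond a collar of three `r(e_k)`-cubes; `|X|`
  instead of the print's weaker `|X|⁻`).
NOT HERE: the "double expansion" (dependence of the letters themselves on `Λ̄^{(m)}_2`), the identification of `A`, `Ω`,
`Λ` with the print's objects, constants not optimized.  No `def`, no `Prop` fact, no `sorry`; axioms standard.
-/

namespace Literature.MathematicalPhysics.QuantumFieldTheory.BalabanImbrieJaffe1984to88.BIJ88NoDirichlet294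

open scoped BigOperators
open Finset
open Literature.MathematicalPhysics.QuantumFieldTheory.Balaban1983to89
open Literature.MathematicalPhysics.QuantumFieldTheory.BalabanImbrieJaffe1984to88
open B4RandomWalk213 B4Sect5RandomWalk B4Sect5CubeBounds BIJ88RandomWalk242 BIJ88Eq242Lattice BIJ88Ineq246Lattice
  BIJ88Eq248Lattice BIJ88DirichletReplacement292
open scoped Matrix

variable {d N : ℕ} {Ω Λ : Finset (Fin d → ℤ)} {γ₀ c₀ δ₀ : ℝ}

/-! ## §1 Labels in close cubes are close -/

/-- two cube labels `s` labels a side whose cube indices differ by at most `2` coordinatewise differ by at most `3s − 1`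
coordinatewise (integer division). [cite: BalabanImbrieJaffe1988, (5.7.10) p.294] -/
theorem abs_sub_le_of_ediv_close {s : ℕ} (hs : 0 < s) {a b : ℤ} (h : |a / (s : ℤ) - b / (s : ℤ)| ≤ 2) :
    |a - b| ≤ 3 * (s : ℤ) - 1 := by
  have hs' : (0 : ℤ) < s := by exact_mod_cast hs
  have ha := Int.mul_ediv_add_emod a s
  have hb := Int.mul_ediv_add_emod b s
  have ra0 := Int.emod_nonneg a hs'.ne'
  have ra1 := Int.emod_lt_of_pos a hs'
  have rb0 := Int.emod_nonneg b hs'.ne'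
  have rb1 := Int.emod_lt_of_pos b hs'
  obtain ⟨h1, h2⟩ := abs_le.mp h
  have m1 : (s : ℤ) * (a / s - b / s) ≤ (s : ℤ) * 2 := mul_le_mul_of_nonneg_left h2 hs'.le
  have m2 : (s : ℤ) * (-2) ≤ (s : ℤ) * (a / s - b / s) := mul_le_mul_of_nonneg_left h1 hs'.le
  rw [abs_le]
  constructor <;> nlinarith [m1, m2, ha, hb, ra0, ra1, rb0, rb1]

/-- labels whose `r(e_k)`-cubes are within cube distance `2` are within `3s − 1` label units.
[cite: BalabanImbrieJaffe1988, (5.7.10) p.294] -/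
theorem dist_le_of_cubeLab_close {s : ℕ} (hs : 0 < s) {l l' : Fin d → ℤ}
    (h : ∀ μ, |cubeLab s l μ - cubeLab s l' μ| ≤ 2) : dist l l' ≤ 3 * (s : ℝ) - 1 := by
  have h0 : (0 : ℝ) ≤ 3 * (s : ℝ) - 1 := by
    have : (1 : ℝ) ≤ s := by exact_mod_cast hs
    linarith
  refine (dist_pi_le_iff h0).mpr fun μ => ?_
  rw [Int.dist_eq]
  exact_mod_cast abs_sub_le_of_ediv_close hs (h μ)

/-! ## §2 The mechanism: a walk whose region is in contact with a block reaches that block -/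

/-- **REACHING THE BOUNDARY COSTS PATH LENGTH.**  For the `ℤ^d` walks of [6] (5.17) on `L²(R; ℝ^N)` (any finite
`R ⊂ ℤ^d`, cubes `M ≥ 1`, `r(e_k)`-cubes of `s ≥ 1` labels): if the walk term of the tuple `cc` does not vanish at
`(x₁,x₂)`, its cube region contains the cube `c`, the cube of a label `l ∈ ℤ^d` touches `c`, and `y` lies in the block
of `l`, then `plen(cc) ≥ dist(x₁,y)/M − 3s − 1` — the walk starts in the block of `x₁` (end-point locality), visits a
label whose cube touches `c` (definition of the region), and labels in cubes within cube distance `2` are within `3s − 1`.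
[cite: BalabanImbrieJaffe1988, (5.7.10) p.294] -/
theorem plen_ge_of_contact {M s : ℕ} (hM : 0 < M) (hs : 0 < s) (A : Matrix (B4.Idx Λ N) (B4.Idx Λ N) ℝ)
    (cc : LTup M Λ) (x₁ x₂ : B4.Idx Λ N) (hval : term M A cc x₁ x₂ ≠ 0) {c : Cubes M s Λ}
    (hc : c ∈ region (cubeOf M s) touch (flatten cc)) {l y : Fin d → ℤ} (hl : Adj (cubeLab s l) c.1)
    (hy : InBox M l y) {D : ℝ} (hD : D * M ≤ dist (x₁.1 : Fin d → ℤ) y) :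
    D - 3 * s - 1 ≤ plen cc := by
  classical
  have hMr : (0 : ℝ) < M := by exact_mod_cast hM
  have hne : term M A cc ≠ 0 := fun h => hval (by rw [h]; rfl)
  have hchain : IsChain cc := isChain_of_term_ne_zero hM A cc hne
  obtain ⟨h1, -⟩ := inBox_of_term_ne_zero hM A cc x₁ x₂ hval
  -- a visited label `l'` whose cube touches `c`
  obtain ⟨l', hl', hlc⟩ : ∃ l' ∈ (flatten cc).pts, touch (cubeOf M s l') c := by
    unfold region at hc
    rcases mem_closure.mp hc with hmet | ⟨c', hc', hcc'⟩
    · obtain ⟨l', hl', rfl⟩ := Finset.mem_image.mp hmet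
      exact ⟨l', hl', touch_refl _⟩
    · obtain ⟨l', hl', rfl⟩ := Finset.mem_image.mp hc'
      exact ⟨l', hl', hcc'⟩
  -- `|l' − l|_∞ ≤ 3s − 1`
  have hll : dist (l'.1 : Fin d → ℤ) l ≤ 3 * (s : ℝ) - 1 := by
    refine dist_le_of_cubeLab_close hs fun μ => ?_
    have a1 : |cubeLab s (l'.1 : Fin d → ℤ) μ - c.1 μ| ≤ 1 := hlc μ
    have a2 : |cubeLab s l μ - c.1 μ| ≤ 1 := hl μ
    have e : cubeLab s (l'.1 : Fin d → ℤ) μ - cubeLab s l μ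
        = (cubeLab s (l'.1 : Fin d → ℤ) μ - c.1 μ) - (cubeLab s l μ - c.1 μ) := by ring
    rw [e]
    exact (abs_sub _ _).trans (by linarith)
  -- the distance chain `x₁ → Mω₀ → Ml' → Ml → y`
  have e1 : dist (x₁.1 : Fin d → ℤ) ((M : ℤ) • (cc.2.1.1 : Fin d → ℤ)) ≤ M := by
    rw [dist_comm]; exact dist_le_of_inBox h1
  have e2 : dist ((M : ℤ) • (cc.2.1.1 : Fin d → ℤ)) ((M : ℤ) • (l'.1 : Fin d → ℤ)) ≤ (M : ℝ) * plen cc :=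
    (dist_smul_le _ _).trans (mul_le_mul_of_nonneg_left (dL_start_le_plen cc hchain hl') hMr.le)
  have e3 : dist ((M : ℤ) • (l'.1 : Fin d → ℤ)) ((M : ℤ) • l) ≤ (M : ℝ) * (3 * (s : ℝ) - 1) :=
    (dist_smul_le _ _).trans (mul_le_mul_of_nonneg_left hll hMr.le)
  have e4 : dist ((M : ℤ) • l) y ≤ M := dist_le_of_inBox hy
  have t1 := dist_triangle (x₁.1 : Fin d → ℤ) ((M : ℤ) • (cc.2.1.1 : Fin d → ℤ)) y
  have t2 := dist_triangle ((M : ℤ) • (cc.2.1.1 : Fin d → ℤ)) ((M : ℤ) • (l'.1 : Fin d → ℤ)) y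
  have t3 := dist_triangle ((M : ℤ) • (l'.1 : Fin d → ℤ)) ((M : ℤ) • l) y
  have key : D * M ≤ (plen cc + 3 * s + 1) * M := by nlinarith [hMr.le]
  have := le_of_mul_le_mul_right key hMr
  linarith

/-! ## §3 The three-factor (2.46): decay in `|x₁ − x₂|`, in `|X|`, and in the distance to the contact block -/

/-- **THE THREE-FACTOR BOUND ON `C_{R,X}`** for the `ℤ^d` operators of [6] (finite `R ⊂ ℤ^d`, `A` with (5.6), `M ≥ 5`,
`M > K_R`, `M > Θ₁`, `θ_W(M) < 1`, `r(e_k)`-cubes of `s ≥ 1` labels, `ρ = s/4`): if the cube set `X` contains a cube `c`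
touched by the cube of a label `l` and `y` lies in the block of `l`, then for all sites with `D·M ≤ dist(x₁,y)`:
`|C_{R,X}(x₁,x₂)| ≤ K₀ · e^{−(δ₀/24)·sdist(x₁,x₂)} · e^{−(δ₀s/(192·9^d))·|X|} · e^{−(δ₀/24)(D − 3s − 1)}`,
`K₀ = 2^dγ₀^{−1}(1−θ_W)^{−1}e^{δ₀/8}` — a contributing walk of the class `X` has path length `≥` each of
`(s/(8·9^d))|X| − 1`, `sdist − 2`, `D − 3s − 1`, hence `≥` their mean. [cite: BalabanImbrieJaffe1988, (5.7.10) p.294] -/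
theorem abs_cX_lattice_le_three (hγ : 0 < γ₀) (hc : 0 ≤ c₀) (hδ : 0 < δ₀) {A : Matrix (B4.Idx Λ N) (B4.Idx Λ N) ℝ}
    (hA : B4.Hyp56 Λ A γ₀ c₀ δ₀) {M : ℕ} (hM : 5 ≤ M) (hMR : kR d N γ₀ c₀ δ₀ < M)
    (hMθ : thetaConst d N γ₀ c₀ δ₀ < M) (hθW : thetaW d N γ₀ c₀ δ₀ M < 1) {s : ℕ} (hs : 0 < s)
    (X : Finset (Cubes M s Λ)) (x₁ x₂ : B4.Idx Λ N) {c : Cubes M s Λ} (hcX : c ∈ X) {l y : Fin d → ℤ}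
    (hl : Adj (cubeLab s l) c.1) (hy : InBox M l y) {D : ℝ} (hD : D * M ≤ dist (x₁.1 : Fin d → ℤ) y) :
    |cX (ldist (N := N) M) ((s : ℝ) / 4) (cubeOf M s) touch (fun ω y₁ y₂ => latticeCw M Λ N A ω y₁ y₂) X x₁ x₂|
      ≤ K0 d N γ₀ c₀ δ₀ M * Real.exp (-(δ₀ / 24) * sdist (N := N) M x₁ x₂)
          * Real.exp (-(δ₀ * s / (192 * 9 ^ d)) * X.card) * Real.exp (-(δ₀ / 24) * (D - 3 * s - 1)) := by
  classical
  have hM0 : 0 < M := by omega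
  set T : Set (Walk ↥(labels M Λ)) :=
    {ω | ¬ Near (ldist (N := N) M) ((s : ℝ) / 4) ω x₁ x₂ ∧ region (cubeOf M s) touch ω = X} with hT
  have hcXeq : cX (ldist (N := N) M) ((s : ℝ) / 4) (cubeOf M s) touch (fun ω y₁ y₂ => latticeCw M Λ N A ω y₁ y₂) X x₁ x₂
      = ∑' cc : LTup M Λ, (flatten ⁻¹' T).indicator (fun cc => term M A cc x₁ x₂) cc := by
    rw [← tsum_indicator_latticeCw_eq A T x₁ x₂]; rfl
  set L : ℝ := (((s : ℝ) / (8 * 9 ^ d) * (X.card : ℝ) - 1) + (sdist (N := N) M x₁ x₂ - 2) + (D - 3 * s - 1)) / 3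
    with hL
  have hSL : ∀ cc ∈ flatten ⁻¹' T, term M A cc x₁ x₂ ≠ 0 → L ≤ plen cc := by
    intro cc hcc hne
    obtain ⟨hfar, hreg⟩ := hcc
    have h1 := plen_ge_of_region hM0 hs A cc x₁ x₂ hne hfar X hreg
    have h2 := sdist_le_plen_add_two hM0 A cc x₁ x₂ hne
    have h3 := plen_ge_of_contact hM0 hs A cc x₁ x₂ hne (hreg ▸ hcX) hl hy hD
    rw [hL]
    linarith
  have hsum' : Summable fun cc : LTup M Λ => ‖(flatten ⁻¹' T).indicator (fun cc => term M A cc x₁ x₂) cc‖ := by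
    simpa only [Real.norm_eq_abs] using (summable_abs_indicator_term hγ hc hδ hA hM hMR hMθ (flatten ⁻¹' T) x₁ x₂)
  have h1' := norm_tsum_le_tsum_norm hsum'
  have h1 : |∑' cc : LTup M Λ, (flatten ⁻¹' T).indicator (fun cc => term M A cc x₁ x₂) cc|
      ≤ ∑' cc : LTup M Λ, |(flatten ⁻¹' T).indicator (fun cc => term M A cc x₁ x₂) cc| := by
    simpa only [Real.norm_eq_abs] using h1'
  have h2 := abs_tsum_class_le hγ hc hδ hA hM hMR hMθ hθW (flatten ⁻¹' T) L x₁ x₂ hSL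
  rw [hcXeq]
  refine h1.trans (h2.trans (le_of_eq ?_))
  rw [K0, hL, mul_assoc (2 ^ d * γ₀⁻¹ * (1 - thetaW d N γ₀ c₀ δ₀ M)⁻¹),
    mul_assoc (2 ^ d * γ₀⁻¹ * (1 - thetaW d N γ₀ c₀ δ₀ M)⁻¹),
    mul_assoc (2 ^ d * γ₀⁻¹ * (1 - thetaW d N γ₀ c₀ δ₀ M)⁻¹), ← Real.exp_add, ← Real.exp_add, ← Real.exp_add]
  congr 2
  ring

/-! ## §4 The expansion of the difference for all sites -/

/-- **THE RANDOM WALK EXPANSION OF THE DIFFERENCE** (p. 294, *"We give a random walk expansion for the difference,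
Σ_X C^{(j)″}(X)"*), for ALL `x₁, x₂ ∈ Λ`: `A^{−1}(x₁,x₂) − A_Λ^{−1}(x₁,x₂) = [C_{Ω,loc}(x₁,x₂) − C_{Λ,loc}(x₁,x₂)] +
Σ_X [C_{Ω,X}(x₁,x₂) − Σ_{Y : ι(Y) = X} C_{Λ,Y}(x₁,x₂)]` — (2.45) for `Ω` and for `Λ`, the `Λ`-sum regrouped along the
push-forward of cube sets; the local bracket vanishes for `x₁` deeper than `(s/4 + 2)M`
(`BIJ88DirichletReplacement292.sub_eq_sum_diffTerm`). [cite: BalabanImbrieJaffe1988, (5.7.10) p.294] -/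
theorem sub_eq_locDiff_add_sum (hγ : 0 < γ₀) (hc : 0 ≤ c₀) (hδ : 0 < δ₀) {A : Matrix (B4.Idx Ω N) (B4.Idx Ω N) ℝ}
    (hA : B4.Hyp56 Ω A γ₀ c₀ δ₀) (hΛ : Λ ⊆ Ω) {M : ℕ} (hM : 5 ≤ M) (hMR : kR d N γ₀ c₀ δ₀ < M)
    (hMθ : thetaConst d N γ₀ c₀ δ₀ < M) (s : ℕ) (ρ : ℝ) (x₁ x₂ : B4.Idx Λ N) :
    (A⁻¹ : Matrix (B4.Idx Ω N) (B4.Idx Ω N) ℝ) (B4.inclIdx hΛ x₁) (B4.inclIdx hΛ x₂)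
        - ((B4.compress hΛ A)⁻¹ : Matrix (B4.Idx Λ N) (B4.Idx Λ N) ℝ) x₁ x₂
      = (cLoc (ldist (N := N) M) ρ (fun ω y₁ y₂ => latticeCw M Ω N A ω y₁ y₂) (B4.inclIdx hΛ x₁) (B4.inclIdx hΛ x₂)
          - cLoc (ldist (N := N) M) ρ (fun ω y₁ y₂ => latticeCw M Λ N (B4.compress hΛ A) ω y₁ y₂) x₁ x₂)
        + ∑ X : Finset (Cubes M s Ω),
          (cX (ldist (N := N) M) ρ (cubeOf M s) touch (fun ω y₁ y₂ => latticeCw M Ω N A ω y₁ y₂) X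
              (B4.inclIdx hΛ x₁) (B4.inclIdx hΛ x₂)
            - ∑ Y ∈ Finset.univ.filter (fun Y : Finset (Cubes M s Λ) => Y.image (eCube M s hΛ) = X),
                cX (ldist (N := N) M) ρ (cubeOf M s) touch
                  (fun ω y₁ y₂ => latticeCw M Λ N (B4.compress hΛ A) ω y₁ y₂) Y x₁ x₂) := by
  classical
  have hΩ := eq245_lattice hγ hc hδ hA hM hMR hMθ (ldist (N := N) M) ρ (cubeOf M s) touch
    (B4.inclIdx hΛ x₁) (B4.inclIdx hΛ x₂)
  have hΛ' := eq245_compress hγ hc hδ hA hΛ hM hMR hMθ (ldist (N := N) M) ρ (cubeOf M s) touch x₁ x₂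
  beta_reduce at hΩ hΛ'
  have hfib : ∑ Y : Finset (Cubes M s Λ), cX (ldist (N := N) M) ρ (cubeOf M s) touch
        (fun ω y₁ y₂ => latticeCw M Λ N (B4.compress hΛ A) ω y₁ y₂) Y x₁ x₂
      = ∑ X : Finset (Cubes M s Ω), ∑ Y ∈ Finset.univ.filter
          (fun Y : Finset (Cubes M s Λ) => Y.image (eCube M s hΛ) = X),
          cX (ldist (N := N) M) ρ (cubeOf M s) touch
            (fun ω y₁ y₂ => latticeCw M Λ N (B4.compress hΛ A) ω y₁ y₂) Y x₁ x₂ :=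
    (Finset.sum_fiberwise Finset.univ (fun Y : Finset (Cubes M s Λ) => Y.image (eCube M s hΛ)) _).symm
  rw [hΩ, hΛ', Finset.sum_sub_distrib, ← hfib]
  ring

/-! ## §5 Cube sets not in contact with `Ω∖Λ` carry no difference term -/

/-- membership in the label set: `l ∈ labels(R)` iff the block of `l` meets `R`. [cite: Balaban1983RegularityDecay, (5.11) p.594] -/
theorem mem_labels_iff {M : ℕ} (hM : 0 < M) {R : Finset (Fin d → ℤ)} {l : Fin d → ℤ} :
    l ∈ labels M R ↔ ∃ x ∈ R, InBox M l x := by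
  unfold labels
  rw [Finset.mem_biUnion]
  exact exists_congr fun x => and_congr_right fun _ => (inBox_iff_mem_cand hM l x).symm

/-- **NO CONTACT ⇒ NO TERM.**  If no label `l` of `Ω` whose cube touches a cube of `X` has a point of `Ω∖Λ` in its
block, then `X` is the push-forward `ι(Y)` of a cube set `Y` of `Λ` away from the boundary (`XFar`), and the difference
term at `X` vanishes for all `x₁, x₂ ∈ Λ` (`BIJ88DirichletReplacement292.diffTerm_eq_zero_of_far`): the difference is
carried by the cube sets REACHING the boundary only — *"exponential localization to B_{m−j}(Λ^{(m)}_3)^c"* (p. 294).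
[cite: BalabanImbrieJaffe1988, (5.7.10) p.294] -/
theorem diffTerm_eq_zero_of_no_contact {M s : ℕ} (hM : 0 < M) (hΛ : Λ ⊆ Ω) (A : Matrix (B4.Idx Ω N) (B4.Idx Ω N) ℝ)
    (ρ : ℝ) {X : Finset (Cubes (d := d) M s Ω)}
    (hX : ¬ ∃ c ∈ X, ∃ l ∈ labels M Ω, Adj (cubeLab s l) c.1 ∧ ∃ y ∈ Ω, y ∉ Λ ∧ InBox M l y)
    (x₁ x₂ : B4.Idx Λ N) :
    cX (ldist (N := N) M) ρ (cubeOf M s) touch (fun ω y₁ y₂ => latticeCw M Ω N A ω y₁ y₂) X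
          (B4.inclIdx hΛ x₁) (B4.inclIdx hΛ x₂)
        - ∑ Y ∈ Finset.univ.filter (fun Y : Finset (Cubes M s Λ) => Y.image (eCube M s hΛ) = X),
            cX (ldist (N := N) M) ρ (cubeOf M s) touch
              (fun ω y₁ y₂ => latticeCw M Λ N (B4.compress hΛ A) ω y₁ y₂) Y x₁ x₂ = 0 := by
  classical
  push Not at hX
  -- every `Ω`-point in the block of a label whose cube touches `X` lies in `Λ`
  have hdeep : ∀ c ∈ X, ∀ l ∈ labels M Ω, Adj (cubeLab s l) c.1 → ∀ y ∈ Ω, InBox M l y → y ∈ Λ := by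
    intro c hc l hl hadj y hy hin
    by_contra hyn
    exact hX c hc l hl hadj y hy hyn hin
  -- hence every cube of `X` is a cube of `Λ`
  have hlab : ∀ c ∈ X, ∃ l ∈ labels M Λ, cubeLab s l = c.1 := by
    intro c hc
    obtain ⟨l, hl, hlc⟩ := Finset.mem_image.mp c.2
    obtain ⟨x, hx, hin⟩ := (mem_labels_iff hM).mp hl
    have hxΛ : x ∈ Λ := hdeep c hc l hl (by rw [hlc]; exact fun μ => by simp) x hx hin
    exact ⟨l, (mem_labels_iff hM).mpr ⟨x, hxΛ, hin⟩, hlc⟩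
  -- the preimage `Y` with `ι(Y) = X`
  set Y : Finset (Cubes M s Λ) := Finset.univ.filter fun c' => eCube M s hΛ c' ∈ X with hY
  have hYX : Y.image (eCube M s hΛ) = X := by
    apply Finset.Subset.antisymm
    · intro c hc
      obtain ⟨c', hc', rfl⟩ := Finset.mem_image.mp hc
      exact (Finset.mem_filter.mp hc').2
    · intro c hc
      obtain ⟨l, hl, hlc⟩ := hlab c hc
      have he : eCube M s hΛ ⟨cubeLab s l, Finset.mem_image_of_mem _ hl⟩ = c := Subtype.ext hlc
      refine Finset.mem_image.mpr ⟨⟨cubeLab s l, Finset.mem_image_of_mem _ hl⟩, ?_, he⟩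
      rw [hY, Finset.mem_filter]
      exact ⟨Finset.mem_univ _, by rw [he]; exact hc⟩
  -- `Y` is far from the boundary
  have hfar : XFar M s Ω Λ Y := by
    intro l hl ⟨c', hc'Y, hadj⟩
    have hcX : eCube M s hΛ c' ∈ X := (Finset.mem_filter.mp hc'Y).2
    have hd : ∀ y ∈ Ω, InBox M l y → y ∈ Λ := hdeep _ hcX l hl hadj
    obtain ⟨x, hx, hin⟩ := (mem_labels_iff hM).mp hl
    exact ⟨(mem_labels_iff hM).mpr ⟨x, hd x hx hin, hin⟩, hd⟩
  rw [← hYX]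
  exact diffTerm_eq_zero_of_far hM hΛ A ρ hfar x₁ x₂

/-! ## §6 *"|C^{(j)″}(X, x₁, x₂)| ≦ e^{−cr|x₁−x₂|}e^{−cr(e_j)|X|⁻}e^{−c dist({x₁,x₂},Λ₃^{(m)c})}"* -/

/-- **THE THREE-FACTOR BOUND ON THE DIFFERENCE TERMS** (p. 294), explicit constants: for finite `Λ ⊆ Ω ⊂ ℤ^d`, `A` on
`L²(Ω; ℝ^N)` with (5.6), `M ≥ 5`, `M > K_R`, `M > Θ₁`, `θ_W(M) < 1`, `r(e_k)`-cubes of `s ≥ 1` labels, `ρ = s/4`, every cube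
set `X` of `Ω`, all `x₁, x₂ ∈ Λ`, and every `D` with `D·M ≤ dist(x₁, y)` for all `y ∈ Ω∖Λ` (`D` = the distance of `x₁` to
the complement in label units):
`|C″(X)(x₁,x₂)| ≤ 2K₀ · e^{−(δ₀/24)·sdist(x₁,x₂)} · e^{−(δ₀s/(192·9^d))·|X|} · e^{−(δ₀/24)(D − 3s − 1)}` — for `X` in contact
with `Ω∖Λ` by `abs_cX_lattice_le_three` for `C_{Ω,X}` and (on the at most one-element fibre, `|Y| = |X|`) for `C_{Λ,Y}`;
for `X` not in contact the term is `0` (`diffTerm_eq_zero_of_no_contact`). [cite: BalabanImbrieJaffe1988, (5.7.10) p.294] -/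
theorem abs_diffTerm_le_three (hγ : 0 < γ₀) (hc : 0 ≤ c₀) (hδ : 0 < δ₀) {A : Matrix (B4.Idx Ω N) (B4.Idx Ω N) ℝ}
    (hA : B4.Hyp56 Ω A γ₀ c₀ δ₀) (hΛ : Λ ⊆ Ω) {M : ℕ} (hM : 5 ≤ M) (hMR : kR d N γ₀ c₀ δ₀ < M)
    (hMθ : thetaConst d N γ₀ c₀ δ₀ < M) (hθW : thetaW d N γ₀ c₀ δ₀ M < 1) {s : ℕ} (hs : 0 < s)
    (X : Finset (Cubes M s Ω)) (x₁ x₂ : B4.Idx Λ N) {D : ℝ}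
    (hD : ∀ y ∈ Ω, y ∉ Λ → D * M ≤ dist (x₁.1.1 : Fin d → ℤ) y) :
    |cX (ldist (N := N) M) ((s : ℝ) / 4) (cubeOf M s) touch (fun ω y₁ y₂ => latticeCw M Ω N A ω y₁ y₂) X
          (B4.inclIdx hΛ x₁) (B4.inclIdx hΛ x₂)
        - ∑ Y ∈ Finset.univ.filter (fun Y : Finset (Cubes M s Λ) => Y.image (eCube M s hΛ) = X),
            cX (ldist (N := N) M) ((s : ℝ) / 4) (cubeOf M s) touch
              (fun ω y₁ y₂ => latticeCw M Λ N (B4.compress hΛ A) ω y₁ y₂) Y x₁ x₂|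
      ≤ 2 * K0 d N γ₀ c₀ δ₀ M * Real.exp (-(δ₀ / 24) * sdist (N := N) M x₁ x₂)
          * Real.exp (-(δ₀ * s / (192 * 9 ^ d)) * X.card) * Real.exp (-(δ₀ / 24) * (D - 3 * s - 1)) := by
  classical
  have hM0 : 0 < M := by omega
  have hK0 : 0 ≤ K0 d N γ₀ c₀ δ₀ M := by
    unfold K0
    have hθ : 0 < 1 - thetaW d N γ₀ c₀ δ₀ M := by linarith
    positivity
  set B : ℝ := K0 d N γ₀ c₀ δ₀ M * Real.exp (-(δ₀ / 24) * sdist (N := N) M x₁ x₂)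
      * Real.exp (-(δ₀ * s / (192 * 9 ^ d)) * X.card) * Real.exp (-(δ₀ / 24) * (D - 3 * s - 1)) with hB
  have hB0 : 0 ≤ B := by rw [hB]; positivity
  by_cases hX : ∃ c ∈ X, ∃ l ∈ labels M Ω, Adj (cubeLab s l) c.1 ∧ ∃ y ∈ Ω, y ∉ Λ ∧ InBox M l y
  · obtain ⟨c, hcX, l, -, hl, y, hyΩ, hyΛ, hy⟩ := hX
    have hDy : D * M ≤ dist ((B4.inclIdx hΛ x₁).1 : Fin d → ℤ) y := hD y hyΩ hyΛ
    -- the Ω-part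
    have hΩ : |cX (ldist (N := N) M) ((s : ℝ) / 4) (cubeOf M s) touch (fun ω y₁ y₂ => latticeCw M Ω N A ω y₁ y₂) X
          (B4.inclIdx hΛ x₁) (B4.inclIdx hΛ x₂)| ≤ B := by
      have h := abs_cX_lattice_le_three hγ hc hδ hA hM hMR hMθ hθW hs X (B4.inclIdx hΛ x₁) (B4.inclIdx hΛ x₂)
        hcX hl hy hDy
      rwa [sdist_inclIdx] at h
    -- the Λ-part: at most one `Y`, with `|Y| = |X|` and the same contact read in `Λ`
    have hAΛ : B4.Hyp56 Λ (B4.compress hΛ A) γ₀ c₀ δ₀ := B6GOmega.hyp56_compress hΛ hγ.le hc hδ.le hA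
    set F := Finset.univ.filter (fun Y : Finset (Cubes M s Λ) => Y.image (eCube M s hΛ) = X) with hF
    have hY : ∀ Y ∈ F, |cX (ldist (N := N) M) ((s : ℝ) / 4) (cubeOf M s) touch
          (fun ω y₁ y₂ => latticeCw M Λ N (B4.compress hΛ A) ω y₁ y₂) Y x₁ x₂| ≤ B := by
      intro Y hYF
      have hYX : Y.image (eCube M s hΛ) = X := (Finset.mem_filter.mp hYF).2
      have hcard : (Y.card : ℝ) = X.card := by
        rw [← hYX, Finset.card_image_of_injective _ (eCube_injective M s hΛ)]
      -- the contact cube `c` pulled back to `Λ`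
      obtain ⟨c', hc'Y, hc'c⟩ : ∃ c' ∈ Y, eCube M s hΛ c' = c := by
        rw [← hYX] at hcX
        exact Finset.mem_image.mp hcX
      have hl' : Adj (cubeLab s l) c'.1 := by
        have : c'.1 = c.1 := by rw [← hc'c]; rfl
        rw [this]; exact hl
      have h := abs_cX_lattice_le_three hγ hc hδ hAΛ hM hMR hMθ hθW hs Y x₁ x₂ hc'Y hl' hy (hD y hyΩ hyΛ)
      rwa [hcard] at h
    have hsum : |∑ Y ∈ F, cX (ldist (N := N) M) ((s : ℝ) / 4) (cubeOf M s) touch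
          (fun ω y₁ y₂ => latticeCw M Λ N (B4.compress hΛ A) ω y₁ y₂) Y x₁ x₂| ≤ B := by
      refine (Finset.abs_sum_le_sum_abs _ _).trans ?_
      refine (Finset.sum_le_sum hY).trans ?_
      rw [Finset.sum_const, nsmul_eq_mul]
      calc (F.card : ℝ) * B ≤ 1 * B :=
            mul_le_mul_of_nonneg_right (by exact_mod_cast card_fiber_le_one hΛ X) hB0
        _ = B := one_mul B
    calc _ ≤ |cX (ldist (N := N) M) ((s : ℝ) / 4) (cubeOf M s) touch (fun ω y₁ y₂ => latticeCw M Ω N A ω y₁ y₂) X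
              (B4.inclIdx hΛ x₁) (B4.inclIdx hΛ x₂)|
            + |∑ Y ∈ F, cX (ldist (N := N) M) ((s : ℝ) / 4) (cubeOf M s) touch
                (fun ω y₁ y₂ => latticeCw M Λ N (B4.compress hΛ A) ω y₁ y₂) Y x₁ x₂| := abs_sub _ _
      _ ≤ B + B := add_le_add hΩ hsum
      _ = _ := by rw [hB]; ring
  · rw [diffTerm_eq_zero_of_no_contact hM0 hΛ A ((s : ℝ) / 4) hX x₁ x₂, abs_zero]
    positivity

end Literature.MathematicalPhysics.QuantumFieldTheory.BalabanImbrieJaffe1984to88.BIJ88NoDirichlet294
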